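import Summits.AtomisticToContinuum.Crystallization.Theorems.ReggeStarCoercivityDefectFreeCrystallizesPalmDefs
import Summits.AtomisticToContinuum.Crystallization.Theorems.PalmUnimodularRigidityShellsToBarlowChartCharts
import Summits.AtomisticToContinuum.Crystallization.Theorems.PalmUnimodularRigidityShellsToBarlowChartCubicGrowthAngle
import Literature.Geometry.DiscreteGeometry.KissingPatterns

/-!
# Links are exact at tolerance `1/20` (stub R1a2 `stub_linkExact` of line `palm-good-law`, crux stmt-AtomisticToContinuum-13603)

Stub `stub_linkExact` of the lead-c4/c5 skeleton `Cruxes/DefectFreeCrystallizes/Lines/palm_good_law.lean` (v15):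
in an everywhere-`SetGood` set `S ⊆ ℝ³` (`Theorems.PalmGoodLaw.SetGood`), for chart data at `x ∈ S` of the
R1a1 format (scale `a ∈ [9/10, 11/10]`, integer pattern `P ∈ {fcc3Int, hcpInt}`, isometry `A`, labelling `nbr`
of the bonded neighbours `{y ∈ S | 0 < dist x y < 6/5}` bijective on `P`, each label within `a/20` of its ideal
position `x + (a/√18)·A t`), two labels `t, t'` that TOUCH (`sqNormInt (t − t') = 18`, ideal distance `a`) label
BONDED points: `0 < dist (nbr t) (nbr t') < 6/5`.

Proof.  `z := nbr t ≠ z' := nbr t'` (`t ≠ t'`, injectivity) and the reading of the pair at `x` gives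
`dist z z' ≤ a + a/10 ≤ 121/100` (`reading`).  Suppose `dist z z' ≥ 6/5`.  The point `z` is `SetGood` with some
scale `b`; `setGood_shell` extracts, AT THAT ONE SCALE, radial pinning (`19b/20 ≤ dist w z ≤ 21b/20` for every
other point `w` of `S` in the open `6/5`-ball of `z`), the `45°` direction fact (for every `d` some such `w` has
`⟪w − z, d⟫ ≥ 0.657·b·‖d‖`, from `fcc_coveringAngle` / `hcp_coveringAngle`) and FOUR SLOTS (every such `w₀` has four
distinct such `w ≠ w₀` with `dist w w₀ ≤ 11b/10`: the four pattern points at distance `1` from the pattern point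
matched to `w₀`, `card_touching` by `decide`).
* `b < 12/11`: the four slots `wᵢ` of `x` in the shell of `z` are bonded to `x` (`11b/10 < 6/5`), hence labelled,
  `wᵢ = nbr sᵢ`; reading `dist wᵢ z ≤ 21b/20` at `x` gives `sqNormInt (sᵢ − t) < 36`, so `= 18` (`touch_of_lt36`);
  the link of `t` in `P` has exactly four labels (`card_touching`), so `t' = sᵢ` for some `i` and
  `dist z z' = dist wᵢ z < 6/5` — contradiction.
* `b ≥ 12/11`: the direction fact for `d := z' − z` gives `w` in the shell of `z` (`r_w := dist w z ≤ 21b/20`) with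
  `dist z' w² ≤ r'² − 1.314·b·r' + r_w² < (19/21)²·r_w²` (`quad_neg`: `r'² − 1.314·b·r' + b²/5 < 0` on
  `[6/5, 121/100] × [12/11, 11/10]`), so `z' ≠ w`, `dist z' w < 6/5`, and radial pinning at the `SetGood` point `w`
  (scale `c`) gives `dist z' w ≥ 19c/20 ≥ (19/21)·dist z w` — contradiction.
-/

noncomputable section

namespace Summit.AtomisticToContinuum.Crystallization.Theorems.PalmGoodLaw.LinkExact

open Literature.MathematicalPhysics.StatisticalMechanics Literature.Geometry.DiscreteGeometry
open Summit.AtomisticToContinuum.Crystallization.Theorems.PalmUnimodularRigidityShellsToBarlowChart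
  (fcc3Int fccKissingPattern_eq_scaledPattern_fcc3Int scale18_injective dist_scale18_eq_one_iff dist_ideal
   sqNormInt_sub_comm sqrt_bounds fcc_coveringAngle hcp_coveringAngle)
open Summit.AtomisticToContinuum.Crystallization.Theorems.ShellsToBarlowChartNegative (sqrt_two_lt')

/-! ## Pattern facts (by `decide`) -/

/-- Every label of `fcc3Int` touches exactly four labels of `fcc3Int`. [folklore] -/
theorem card_touching_fcc : ∀ t₀ ∈ fcc3Int, (fcc3Int.filter fun s => sqNormInt (s - t₀) = 18).card = 4 := by
  decide

/-- Every label of `hcpInt` touches exactly four labels of `hcpInt`. [folklore] -/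
theorem card_touching_hcp : ∀ t₀ ∈ hcpInt, (hcpInt.filter fun s => sqNormInt (s - t₀) = 18).card = 4 := by
  decide

/-- Two distinct labels of `fcc3Int` at squared distance `< 36` touch. [folklore] -/
theorem touch_of_lt36_fcc : ∀ v ∈ fcc3Int, ∀ w ∈ fcc3Int, v ≠ w → sqNormInt (v - w) < 36 →
    sqNormInt (v - w) = 18 := by
  decide

/-- Two distinct labels of `hcpInt` at squared distance `< 36` touch. [folklore] -/
theorem touch_of_lt36_hcp : ∀ v ∈ hcpInt, ∀ w ∈ hcpInt, v ≠ w → sqNormInt (v - w) < 36 →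
    sqNormInt (v - w) = 18 := by
  decide

/-- The link of a label in either integer pattern has exactly four labels. [folklore] -/
theorem card_touching {P : Finset (Fin 3 → ℤ)} (hP : P = fcc3Int ∨ P = hcpInt) {t₀ : Fin 3 → ℤ} (ht₀ : t₀ ∈ P) :
    (P.filter fun s => sqNormInt (s - t₀) = 18).card = 4 := by
  rcases hP with rfl | rfl
  · exact card_touching_fcc t₀ ht₀
  · exact card_touching_hcp t₀ ht₀

/-- Two distinct labels of either integer pattern at squared distance `< 36` touch. [folklore] -/
theorem touch_of_lt36 {P : Finset (Fin 3 → ℤ)} (hP : P = fcc3Int ∨ P = hcpInt) {v w : Fin 3 → ℤ} (hv : v ∈ P)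
    (hw : w ∈ P) (hne : v ≠ w) (hlt : sqNormInt (v - w) < 36) : sqNormInt (v - w) = 18 := by
  rcases hP with rfl | rfl
  · exact touch_of_lt36_fcc v hv w hw hne hlt
  · exact touch_of_lt36_hcp v hv w hw hne hlt

/-- **Four slots in the real pattern.**  Every point `q` of `scaledPattern P 18` (`P = fcc3Int` or `hcpInt`) has four
pattern points at distance exactly `1`, injectively indexed by `Fin 4`. [folklore] -/
theorem four_slots {P : Finset (Fin 3 → ℤ)} (hP : P = fcc3Int ∨ P = hcpInt) {q : EuclideanSpace ℝ (Fin 3)}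
    (hq : q ∈ scaledPattern P 18) :
    ∃ p : Fin 4 → EuclideanSpace ℝ (Fin 3), Function.Injective p ∧
      ∀ i, p i ∈ scaledPattern P 18 ∧ dist (p i) q = 1 := by
  obtain ⟨t₀, ht₀, rfl⟩ := Finset.mem_image.1 hq
  have hcard := card_touching hP ht₀
  obtain ⟨u, hu, huF⟩ : ∃ u : Fin 4 → (Fin 3 → ℤ), Function.Injective u ∧
      ∀ i, u i ∈ P.filter fun s => sqNormInt (s - t₀) = 18 :=
    ⟨fun i => ((Finset.equivFinOfCardEq hcard).symm i).1,
      fun i j h => (Finset.equivFinOfCardEq hcard).symm.injective (Subtype.ext h),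
      fun i => ((Finset.equivFinOfCardEq hcard).symm i).2⟩
  refine ⟨fun i => (Real.sqrt 18)⁻¹ • intVec (u i), fun i j h => hu (scale18_injective h), fun i => ?_⟩
  obtain ⟨hiP, hi18⟩ := Finset.mem_filter.1 (huF i)
  exact ⟨Finset.mem_image_of_mem _ hiP, (dist_scale18_eq_one_iff _ _).2 hi18⟩

/-! ## Shell facts at a `SetGood` point, at one scale -/

/-- **Shell facts at a `SetGood` point `y` of `S`, all at ONE admissible scale `a`.**  (i) RADIAL PINNING: every other
point of `S` in the open `6/5`-ball of `y` is at distance `∈ [19a/20, 21a/20]`; (ii) DIRECTION: for every vector `d`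
some such point `w` has `⟪w − y, d⟫ ≥ 0.657·a·‖d‖` (the `45°` covering angle of both patterns, up to the matching error
`1/20`); (iii) FOUR SLOTS: every such point `x` has four distinct such points `w ≠ x` with `dist w x ≤ 11a/10` (the
shell points matched to the four pattern neighbours of the pattern point matched to `x`). [folklore] -/
theorem setGood_shell {S : Set (EuclideanSpace ℝ (Fin 3))} {y : EuclideanSpace ℝ (Fin 3)} (h : SetGood S y) :
    ∃ a : ℝ, 9 / 10 ≤ a ∧ a ≤ 11 / 10 ∧
      (∀ w ∈ S, w ≠ y → dist w y < 6 / 5 → 19 / 20 * a ≤ dist w y ∧ dist w y ≤ 21 / 20 * a) ∧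
      (∀ d : EuclideanSpace ℝ (Fin 3), ∃ w ∈ S, w ≠ y ∧ dist w y < 6 / 5 ∧
        657 / 1000 * a * ‖d‖ ≤ inner ℝ (w - y) d) ∧
      (∀ x ∈ S, x ≠ y → dist x y < 6 / 5 → ∃ w : Fin 4 → EuclideanSpace ℝ (Fin 3), Function.Injective w ∧
        ∀ i, w i ∈ S ∧ w i ≠ y ∧ dist (w i) y < 6 / 5 ∧ w i ≠ x ∧ dist (w i) x ≤ 11 / 10 * a) := by
  obtain ⟨a, ha9, ha11, T, hT, hclose⟩ := h
  -- uniformise the two patterns: unit vectors, `45°` covering angle, four slots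
  obtain ⟨P, hP1, hPcov, hP4, A, e, he⟩ : ∃ P : Finset (EuclideanSpace ℝ (Fin 3)),
      (∀ v ∈ P, ‖v‖ = 1) ∧
      (∀ u : EuclideanSpace ℝ (Fin 3), ∃ v ∈ P, ‖u‖ ≤ Real.sqrt 2 * inner ℝ u v) ∧
      (∀ q ∈ P, ∃ p : Fin 4 → EuclideanSpace ℝ (Fin 3), Function.Injective p ∧
        ∀ i, p i ∈ P ∧ dist (p i) q = 1) ∧
      ∃ A : EuclideanSpace ℝ (Fin 3) →ₗᵢ[ℝ] EuclideanSpace ℝ (Fin 3), ∃ e : ↥T ≃ ↥(P.image A),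
        ∀ t : ↥T, dist (t : EuclideanSpace ℝ (Fin 3)) (e t) ≤ 1 / 20 := by
    rcases hclose with ⟨A, e, he⟩ | ⟨A, e, he⟩
    · refine ⟨fccKissingPattern, fun v hv => norm_eq_one_of_mem_fccKissingPattern hv, fcc_coveringAngle,
        fun q hq => ?_, A, e, he⟩
      rw [fccKissingPattern_eq_scaledPattern_fcc3Int] at hq ⊢
      exact four_slots (Or.inl rfl) hq
    · exact ⟨hcpKissingPattern, fun v hv => norm_eq_one_of_mem_hcpKissingPattern hv, hcp_coveringAngle,
        fun q hq => four_slots (Or.inr rfl) hq, A, e, he⟩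
  have ha0 : 0 < a := by linarith
  -- shell points are rescaled recentred points of `S`, and conversely
  have hTS : ∀ t ∈ T, y + a • t ∈ S ∧ y + a • t ≠ y ∧ dist (y + a • t) y < 6 / 5 := by
    intro t ht
    have ht' : t ∈ (↑T : Set (EuclideanSpace ℝ (Fin 3))) := ht
    rw [hT] at ht'
    obtain ⟨w, hw, hwt⟩ := ht'
    have hwt' : a⁻¹ • (w - y) = t := hwt
    have hw' : y + a • t = w := by
      rw [← hwt', smul_smul, mul_inv_cancel₀ ha0.ne', one_smul, add_sub_cancel]
    rw [hw']
    exact hw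
  have hmemT : ∀ w ∈ S, w ≠ y → dist w y < 6 / 5 → a⁻¹ • (w - y) ∈ T := by
    intro w hw hne hlt
    rw [← Finset.mem_coe, hT]
    exact ⟨w, ⟨hw, hne, hlt⟩, rfl⟩
  -- matched pattern points are unit vectors
  have hunit : ∀ t : ↥T, ‖((e t : ↥(P.image A)) : EuclideanSpace ℝ (Fin 3))‖ = 1 := by
    intro t
    obtain ⟨p, hp, hpq⟩ := Finset.mem_image.1 (e t).2
    rw [← hpq, A.norm_map, hP1 p hp]
  refine ⟨a, ha9, ha11, ?_, ?_, ?_⟩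
  · -- (i) radial pinning at the scale `a`
    intro w hw hne hlt
    have ht := hmemT w hw hne hlt
    have h1 := abs_norm_sub_norm_le (a⁻¹ • (w - y)) ((e ⟨_, ht⟩ : ↥(P.image A)) : EuclideanSpace ℝ (Fin 3))
    have h2 : ‖a⁻¹ • (w - y) - ((e ⟨_, ht⟩ : ↥(P.image A)) : EuclideanSpace ℝ (Fin 3))‖ ≤ 1 / 20 := by
      rw [← dist_eq_norm]; exact he ⟨_, ht⟩
    rw [hunit, norm_smul, norm_inv, Real.norm_of_nonneg ha0.le, abs_le] at h1
    have hlo : a * (19 / 20) ≤ a * (a⁻¹ * ‖w - y‖) := mul_le_mul_of_nonneg_left (by linarith [h1.1]) ha0.le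
    have hhi : a * (a⁻¹ * ‖w - y‖) ≤ a * (21 / 20) := mul_le_mul_of_nonneg_left (by linarith [h1.2]) ha0.le
    rw [← mul_assoc, mul_inv_cancel₀ ha0.ne', one_mul] at hlo hhi
    rw [dist_eq_norm]
    constructor <;> linarith
  · -- (ii) direction (the `45°` covering angle, as in `FunnelCovering.shellDir`)
    intro d
    obtain ⟨d', hd'⟩ : ∃ d' : EuclideanSpace ℝ (Fin 3), A d' = d :=
      ⟨(A.toLinearIsometryEquiv rfl).symm d, by
        rw [← LinearIsometry.coe_toLinearIsometryEquiv A rfl]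
        exact (A.toLinearIsometryEquiv rfl).apply_symm_apply d⟩
    have hnd : ‖d'‖ = ‖d‖ := by rw [← hd', LinearIsometry.norm_map]
    obtain ⟨v, hv, hcov⟩ := hPcov d'
    have hq : A v ∈ P.image A := Finset.mem_image_of_mem _ hv
    obtain ⟨t, ht⟩ : ∃ t : ↥T, e t = ⟨A v, hq⟩ := ⟨e.symm _, e.apply_symm_apply _⟩
    obtain ⟨htS, htne, htlt⟩ := hTS t.1 t.2
    have h1 : ‖t.1 - A v‖ ≤ 1 / 20 := by
      have := he t
      rwa [ht, dist_eq_norm] at this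
    refine ⟨y + a • t.1, htS, htne, htlt, ?_⟩
    have hinner : inner ℝ (A v) d = inner ℝ d' v := by
      rw [← hd', LinearIsometry.inner_map_map, real_inner_comm]
    have hI0 : 0 ≤ inner ℝ d' v :=
      (mul_nonneg_iff_of_pos_left (by positivity)).1 ((norm_nonneg d').trans hcov)
    have hI : 707 / 1000 * ‖d‖ ≤ inner ℝ d' v := by
      have h2 : ‖d'‖ ≤ 14143 / 10000 * inner ℝ d' v :=
        hcov.trans (mul_le_mul_of_nonneg_right sqrt_two_lt'.le hI0)
      rw [hnd] at h2
      linarith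
    have herr : |inner ℝ (t.1 - A v) d| ≤ 1 / 20 * ‖d‖ :=
      (abs_real_inner_le_norm _ _).trans (mul_le_mul_of_nonneg_right h1 (norm_nonneg _))
    have hsplit : inner ℝ t.1 d = inner ℝ (A v) d + inner ℝ (t.1 - A v) d := by
      rw [inner_sub_left]; ring
    have ht657 : 657 / 1000 * ‖d‖ ≤ inner ℝ t.1 d := by
      rw [hsplit, hinner]
      rw [abs_le] at herr
      linarith [herr.1]
    rw [add_sub_cancel_left, real_inner_smul_left]
    linarith [mul_le_mul_of_nonneg_left ht657 ha0.le]
  · -- (iii) four slots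
    intro x hx hxy hxlt
    have hxT := hmemT x hx hxy hxlt
    obtain ⟨q, hq, hqx⟩ := Finset.mem_image.1 (e ⟨_, hxT⟩).2
    obtain ⟨p, hpinj, hp⟩ := hP4 q hq
    have hpm : ∀ i, A (p i) ∈ P.image A := fun i => Finset.mem_image_of_mem _ (hp i).1
    obtain ⟨u, hu⟩ : ∃ u : Fin 4 → ↥T, ∀ i, e (u i) = ⟨A (p i), hpm i⟩ :=
      ⟨fun i => e.symm ⟨A (p i), hpm i⟩, fun i => e.apply_symm_apply _⟩
    have heu : ∀ i, ((e (u i) : ↥(P.image A)) : EuclideanSpace ℝ (Fin 3)) = A (p i) :=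
      fun i => congrArg Subtype.val (hu i)
    refine ⟨fun i => y + a • ((u i : ↥T) : EuclideanSpace ℝ (Fin 3)), ?_, fun i => ?_⟩
    · intro i j hij
      dsimp only at hij
      have h1 : a • ((u i : ↥T) : EuclideanSpace ℝ (Fin 3)) = a • ((u j : ↥T) : EuclideanSpace ℝ (Fin 3)) :=
        add_left_cancel hij
      have h2 : u i = u j := Subtype.ext (smul_right_injective _ ha0.ne' h1)
      have h3 : A (p i) = A (p j) := by rw [← heu i, ← heu j, h2]
      exact hpinj (A.injective h3)
    · obtain ⟨hS', hne, hlt⟩ := hTS (u i).1 (u i).2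
      refine ⟨hS', hne, hlt, ?_, ?_⟩
      · -- `≠ x`: the slot `p i` is not the pattern point `q` of `x`
        intro hwx
        have h1 : ((u i : ↥T) : EuclideanSpace ℝ (Fin 3)) = a⁻¹ • (x - y) := by
          rw [← hwx, add_sub_cancel_left, smul_smul, inv_mul_cancel₀ ha0.ne', one_smul]
        have h2 : u i = ⟨_, hxT⟩ := Subtype.ext h1
        have h3 : A (p i) = A q := by rw [← heu i, h2, hqx]
        have h4 := (hp i).2
        rw [A.injective h3, dist_self] at h4
        exact zero_ne_one h4
      · -- distance to `x`: `a · (1/20 + 1 + 1/20)`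
        have h1 : dist ((u i : ↥T) : EuclideanSpace ℝ (Fin 3)) (A (p i)) ≤ 1 / 20 := by
          have := he (u i)
          rwa [heu i] at this
        have h2 : dist (a⁻¹ • (x - y)) (A q) ≤ 1 / 20 := by
          have := he ⟨_, hxT⟩
          rwa [← hqx] at this
        have h3 : dist (A (p i)) (A q) = 1 := by rw [A.dist_map]; exact (hp i).2
        have h4 : dist ((u i : ↥T) : EuclideanSpace ℝ (Fin 3)) (a⁻¹ • (x - y)) ≤ 11 / 10 := by
          have := dist_triangle4 ((u i : ↥T) : EuclideanSpace ℝ (Fin 3)) (A (p i)) (A q) (a⁻¹ • (x - y))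
          rw [dist_comm (A q)] at this
          linarith
        have h5 : y + a • ((u i : ↥T) : EuclideanSpace ℝ (Fin 3)) - x =
            a • (((u i : ↥T) : EuclideanSpace ℝ (Fin 3)) - a⁻¹ • (x - y)) := by
          rw [smul_sub, smul_smul, mul_inv_cancel₀ ha0.ne', one_smul]
          abel
        rw [dist_eq_norm, h5, norm_smul, Real.norm_of_nonneg ha0.le, ← dist_eq_norm]
        linarith [mul_le_mul_of_nonneg_left h4 ha0.le]

/-! ## Readings and the quadratic inequality -/

/-- **Reading a distance in a `1/20`-chart**: two labelled neighbours `s, s'` are at distance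
`(a/√18)·√(sqNormInt (s − s')) ± a/10`. [folklore] -/
theorem reading {a : ℝ} (ha : 0 ≤ a) {P : Finset (Fin 3 → ℤ)} {x : EuclideanSpace ℝ (Fin 3)}
    {A : EuclideanSpace ℝ (Fin 3) →ₗᵢ[ℝ] EuclideanSpace ℝ (Fin 3)} {nbr : (Fin 3 → ℤ) → EuclideanSpace ℝ (Fin 3)}
    (hcl : ∀ t ∈ P, dist (nbr t) (x + (a * (Real.sqrt 18)⁻¹) • A (intVec t)) ≤ a / 20)
    {s s' : Fin 3 → ℤ} (hs : s ∈ P) (hs' : s' ∈ P) :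
    |dist (nbr s) (nbr s') - a * (Real.sqrt 18)⁻¹ * Real.sqrt (sqNormInt (s - s') : ℝ)| ≤ a / 10 := by
  have h1 := hcl s hs
  have h2 := hcl s' hs'
  rw [← dist_ideal ha x A s s']
  set p : EuclideanSpace ℝ (Fin 3) := x + (a * (Real.sqrt 18)⁻¹) • A (intVec s)
  set p' : EuclideanSpace ℝ (Fin 3) := x + (a * (Real.sqrt 18)⁻¹) • A (intVec s')
  have e1 : |dist (nbr s) (nbr s') - dist p (nbr s')| ≤ dist (nbr s) p := abs_dist_sub_le _ _ _
  have e2 : |dist (nbr s') p - dist p' p| ≤ dist (nbr s') p' := abs_dist_sub_le _ _ _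
  rw [dist_comm (nbr s') p, dist_comm p' p] at e2
  rw [abs_le] at e1 e2 ⊢
  constructor <;> linarith [e1.1, e1.2, e2.1, e2.2]

/-- **The quadratic inequality of the `45°` exclusion**: `r² − 1.314·b·r + b²/5 < 0` for `r ∈ [6/5, 121/100]`,
`b ∈ [12/11, 11/10]` (corner maximum `≈ −0.032`). [folklore] -/
theorem quad_neg {r b : ℝ} (hr1 : 6 / 5 ≤ r) (hr2 : r ≤ 121 / 100) (hb1 : 12 / 11 ≤ b) (hb2 : b ≤ 11 / 10) :
    r ^ 2 - 1314 / 1000 * b * r + b ^ 2 / 5 < 0 := by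
  nlinarith [mul_nonneg (sub_nonneg.2 hr1) (sub_nonneg.2 hr2), mul_nonneg (sub_nonneg.2 hb1) (sub_nonneg.2 hb2),
    mul_nonneg (sub_nonneg.2 hr1) (sub_nonneg.2 hb1)]

/-! ## The stub -/

/-- **R1a2 `stub_linkExact` of line `palm-good-law`: links are exact at tolerance `1/20`.**  In an
everywhere-`SetGood` set, two labelled neighbours of a point whose labels touch (squared label distance `18`, ideal
distance `a`) ARE bonded (distance in `(0, 6/5)`), for arbitrary chart data at `x` of the R1a1 format. [folklore] -/
theorem stub_linkExact :
    ∀ S : Set (EuclideanSpace ℝ (Fin 3)), (∀ x ∈ S, SetGood S x) →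
      ∀ x ∈ S, ∀ (a : ℝ) (P : Finset (Fin 3 → ℤ))
        (A : EuclideanSpace ℝ (Fin 3) →ₗᵢ[ℝ] EuclideanSpace ℝ (Fin 3)) (nbr : (Fin 3 → ℤ) → EuclideanSpace ℝ (Fin 3)),
        (P = fcc3Int ∨ P = hcpInt) → 9 / 10 ≤ a → a ≤ 11 / 10 →
        Set.BijOn nbr (↑P : Set (Fin 3 → ℤ)) {y | y ∈ S ∧ (0 < dist x y ∧ dist x y < 6 / 5)} →
        (∀ t ∈ P, dist (nbr t) (x + (a * (Real.sqrt 18)⁻¹) • A (intVec t)) ≤ a / 20) →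
        ∀ t ∈ P, ∀ t' ∈ P, sqNormInt (t - t') = 18 →
          (0 < dist (nbr t) (nbr t') ∧ dist (nbr t) (nbr t') < 6 / 5) := by
  intro S hS x hx a P A nbr hP ha9 ha11 hbij hcl t ht t' ht' htt
  have ha0 : 0 < a := by linarith
  obtain ⟨hzS, hzpos, hzlt⟩ := hbij.mapsTo ht
  obtain ⟨hz'S, -, -⟩ := hbij.mapsTo ht'
  have htne : t ≠ t' := by
    rintro rfl
    simp [sqNormInt] at htt
  have hne : nbr t ≠ nbr t' := fun h => htne (hbij.injOn ht ht' h)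
  refine ⟨dist_pos.2 hne, ?_⟩
  -- (0) reading of the touching pair at `x`: `dist ≤ a + a/10 ≤ 121/100`
  have hr := reading ha0.le hcl ht ht'
  have h18 : a * (Real.sqrt 18)⁻¹ * Real.sqrt ((18 : ℤ) : ℝ) = a := by
    rw [Int.cast_ofNat, mul_assoc, inv_mul_cancel₀ (by positivity), mul_one]
  rw [htt, h18, abs_le] at hr
  by_contra hge
  rw [not_lt] at hge
  -- (1) shell facts at the `SetGood` point `z := nbr t`, at its scale `b`
  obtain ⟨b, -, hb11, hpin, hdir, hfour⟩ := setGood_shell (hS (nbr t) hzS)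
  have hxz : x ≠ nbr t := fun h => by
    rw [h, dist_self] at hzpos
    exact lt_irrefl _ hzpos
  by_cases hb12 : b < 12 / 11
  · -- (2) `b < 12/11`: the four slots of `x` in the shell of `z` are labelled at `x` and fill the link of `t`
    obtain ⟨w, hwinj, hw⟩ := hfour x hx hxz hzlt
    have hwN : ∀ i, w i ∈ {y | y ∈ S ∧ (0 < dist x y ∧ dist x y < 6 / 5)} := fun i =>
      ⟨(hw i).1, dist_pos.2 (hw i).2.2.2.1.symm, by rw [dist_comm]; linarith [(hw i).2.2.2.2]⟩
    have hlab : ∀ i, ∃ s, s ∈ P ∧ nbr s = w i := fun i => hbij.surjOn (hwN i)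
    choose s hsP hsw using hlab
    have hst : ∀ i, sqNormInt (s i - t) = 18 := by
      intro i
      have hsne : s i ≠ t := fun h => (hw i).2.1 (by rw [← hsw i, h])
      have hrd := reading ha0.le hcl (hsP i) ht
      rw [hsw i, abs_le] at hrd
      have hdz := (hpin (w i) (hw i).1 (hw i).2.1 (hw i).2.2.1).2
      refine touch_of_lt36 hP (hsP i) ht hsne ?_
      by_contra h36
      rw [not_lt] at h36
      obtain ⟨b18u, -, b36, -⟩ := sqrt_bounds
      have h6 : Real.sqrt 36 ≤ Real.sqrt (sqNormInt (s i - t) : ℝ) := Real.sqrt_le_sqrt (by exact_mod_cast h36)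
      rw [b36] at h6
      have hK : (10000 / 42427 : ℝ) < (Real.sqrt 18)⁻¹ := by
        rw [lt_inv_comm₀ (by norm_num) (by positivity), inv_div]
        exact b18u
      have h1 := mul_le_mul_of_nonneg_left h6 (by positivity : (0 : ℝ) ≤ a * (Real.sqrt 18)⁻¹)
      have h2 := mul_lt_mul_of_pos_left hK (by positivity : (0 : ℝ) < 6 * a)
      nlinarith
    have hsinj : Function.Injective s := fun i j h => hwinj (by rw [← hsw i, ← hsw j, h])
    have hsub : Finset.univ.image s ⊆ P.filter fun u => sqNormInt (u - t) = 18 := by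
      intro u hu
      obtain ⟨i, -, rfl⟩ := Finset.mem_image.1 hu
      exact Finset.mem_filter.2 ⟨hsP i, hst i⟩
    have hle : (P.filter fun u => sqNormInt (u - t) = 18).card ≤ (Finset.univ.image s).card :=
      le_of_eq (by rw [card_touching hP ht, Finset.card_image_of_injective _ hsinj, Finset.card_univ,
        Fintype.card_fin])
    have ht'mem : t' ∈ P.filter fun u => sqNormInt (u - t) = 18 :=
      Finset.mem_filter.2 ⟨ht', by rw [sqNormInt_sub_comm]; exact htt⟩
    rw [← Finset.eq_of_subset_of_card_le hsub hle] at ht'mem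
    obtain ⟨i, -, hi⟩ := Finset.mem_image.1 ht'mem
    have hlt := (hw i).2.2.1
    rw [← hsw i, hi, dist_comm] at hlt
    linarith
  · -- (3) `b ≥ 12/11`: the `45°` exclusion of a thirteenth point
    rw [not_lt] at hb12
    obtain ⟨w, hwS, hwz, hwlt, hinner⟩ := hdir (nbr t' - nbr t)
    obtain ⟨-, hrhi⟩ := hpin w hwS hwz hwlt
    have hexp : dist (nbr t') w ^ 2 =
        dist (nbr t) (nbr t') ^ 2 - 2 * inner ℝ (nbr t' - nbr t) (w - nbr t) + dist w (nbr t) ^ 2 := by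
      rw [dist_eq_norm (nbr t') w, dist_comm (nbr t) (nbr t'), dist_eq_norm (nbr t') (nbr t),
        dist_eq_norm w (nbr t), ← norm_sub_sq_real, sub_sub_sub_cancel_right]
    rw [real_inner_comm, ← dist_eq_norm, dist_comm] at hinner
    have hsq : dist w (nbr t) ^ 2 ≤ (21 / 20 * b) ^ 2 := pow_le_pow_left₀ dist_nonneg hrhi 2
    have hq := quad_neg hge (by linarith [hr.2]) hb12 hb11
    have hlt2 : dist (nbr t') w ^ 2 < (19 / 21 * dist w (nbr t)) ^ 2 := by
      rw [hexp]
      nlinarith [hq, hinner, hsq]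
    have hlt1 : dist (nbr t') w < 19 / 21 * dist w (nbr t) := lt_of_pow_lt_pow_left₀ 2 (by positivity) hlt2
    have hz'w : nbr t' ≠ w := by
      intro h
      rw [← h, dist_comm] at hrhi
      linarith
    have hz'lt : dist (nbr t') w < 6 / 5 := by linarith
    have hzw : dist (nbr t) w < 6 / 5 := by rw [dist_comm]; exact hwlt
    -- radial pinning at the `SetGood` point `w` (scale `c`): `dist z' w ≥ 19c/20 ≥ (19/21) dist z w`
    obtain ⟨c, -, -, hpinw, -, -⟩ := setGood_shell (hS w hwS)
    have h1 := (hpinw (nbr t') hz'S hz'w hz'lt).1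
    have h2 := (hpinw (nbr t) hzS hwz.symm hzw).2
    rw [dist_comm] at h2
    linarith

end Summit.AtomisticToContinuum.Crystallization.Theorems.PalmGoodLaw.LinkExact

end
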